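import Mathlib.RingTheory.Ideal.UFD
import Mathlib.RingTheory.Ideal.Height
import Mathlib.RingTheory.Ideal.MinimalPrime.Noetherian
import Mathlib.RingTheory.Localization.AtPrime.Basic
import Mathlib.RingTheory.Localization.FractionRing
import Mathlib.RingTheory.PrincipalIdealDomain
import HarnessLib

/-!
# Factorial domains: the intersection of the localizations at height-one primes, principal
radical ideals, and spreading out a local generator

Elementary facts about a factorial domain `R` (with fraction field `K`) through which the theorem
of Auslander–Buchsbaum ("a regular local ring is a UFD"; in this tree the named fact
`Literature.AlgebraicGeometry.Resolution.Matsumura1987_20_3`, Matsumura Thm. 20.3 /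
Görtz–Wedhorn I, Prop. B.77 (2); regular ⇒ domain is proved there,
`Literature.AlgebraicGeometry.Resolution.isDomain_of_isRegularLocalRing`) is *used* in
Görtz–Wedhorn II, Lemma 25.150 ("`X ∖ U` is an effective Cartier divisor on a noetherian
separated regular scheme"; `Motives/CartierDivisorEffective`, `Motives/CartierDivisorOfComplement`).
All proved:

* `exists_algebraMap_eq_of_forall_prime` — **`R = ⋂_𝔭 R_𝔭` over the height-one primes**
  (Görtz–Wedhorn I, Prop. B.73 (3) (a) / Matsumura Thm. 11.5 for normal noetherian domains; here
  for factorial domains, whose height-one primes are the `(π)`, `π` prime — Mathlib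
  `UniqueFactorizationMonoid.isPrincipal_of_height_eq_one` — and the proof is induction on the
  prime factorisation of a denominator): if `x ∈ K` can be written with a denominator prime to `π`
  for every prime element `π`, then `x ∈ R`;
* `iInf_span_singleton_eq_span_prod`, `exists_eq_span_singleton_of_isRadical` — a radical ideal
  of a noetherian factorial domain all of whose minimal primes have height one is principal
  (`⋂ (πᵢ) = (∏ πᵢ)` for pairwise non-associated primes; Görtz–Wedhorn I, Prop. B.75 (2):
  height-one primes of a factorial noetherian domain are principal);
* `exists_notMem_forall_mul_mem_of_fg` with `exists_mul_eq_of_map_le_span` and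
  `map_eq_span_of_forall_mul_eq` — spreading out a generator: if the finitely generated ideal `J`
  becomes principal, generated by `j ∈ J`, in the localization at a prime `𝔮`, then one `g ∉ 𝔮`
  works for all of `J` (`g x ∈ j R` for `x ∈ J`), hence `J R_𝔭 = j R_𝔭` for every prime `𝔭 ∌ g`.

Mathlib searched (pin): `UniqueFactorizationMonoid.isPrincipal_of_height_eq_one` and
`Ideal.eq_span_singleton_of_height_eq_one` (`RingTheory/Ideal/UFD.lean`),
`Submodule.IsPrincipal.prime_generator_of_isPrime`, `UniqueFactorizationMonoid.induction_on_prime`,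
`Ideal.sInf_minimalPrimes`, `Ideal.finite_minimalPrimes_of_isNoetherianRing`,
`Ideal.iInf_span_singleton` (needs pairwise `IsCoprime`, so not what is needed here),
`IsFractionRing.div_surjective`, `IsLocalization.eq_iff_exists` (all used or compared); Mathlib has
no Krull domains and no "UFD is the intersection of its localizations at height-one primes".
Literature searched: `Literature/AlgebraicGeometry/Resolution/RegularLocalRings*.lean` (the named
facts Matsumura 14.3 / 19.3 / 19.4 / 20.3 and their partial discharges), nothing on this topic.

## References

* U. Görtz, T. Wedhorn, *Algebraic Geometry I: Schemes*, 2nd ed., Springer Spektrum (2020),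
  doi:10.1007/978-3-658-30733-2: Appendix (B.14), Prop. B.73 (3), Prop./Def. B.74, Prop. B.75 (2)
  (p. 571), Prop. B.77 (2) and Remark B.78 (1) (p. 572). [GortzWedhorn2020]
* H. Matsumura, *Commutative Ring Theory*, Cambridge (1987): Thm. 11.5, Thm. 20.1, Thm. 20.3.
  [Matsumura1987]
-/

open Ideal

namespace Literature.RingTheory.UniqueFactorizationDomain

/-! ### The intersection of the localizations at height-one primes -/

section UFD

variable {R : Type*} [CommRing R] [IsDomain R]

/-- **A factorial domain is the intersection of its localizations at height-one primes**
(Görtz–Wedhorn I, Prop. B.73 (3) (a) with Remark B.78 (1); Matsumura, Thm. 11.5), in the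
elementary form: if `x ∈ K = Frac R` admits, for every prime element `π` of `R`, a denominator
not divisible by `π` (`x · e = d` with `π ∤ e`), then `x ∈ R`. Proof by induction on the prime
factorisation of a denominator of `x`. [cite: GortzWedhorn2020, Prop. B.73 (3) (a) (p. 571) with Remark B.78 (1) (p. 572)] -/
theorem exists_algebraMap_eq_of_forall_prime [UniqueFactorizationMonoid R] {K : Type*} [Field K]
    [Algebra R K] [IsFractionRing R K] (x : K)
    (hx : ∀ π : R, Prime π → ∃ d e : R, ¬ π ∣ e ∧ x * algebraMap R K e = algebraMap R K d) :
    ∃ r : R, algebraMap R K r = x := by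
  obtain ⟨a, b, hb, rfl⟩ := IsFractionRing.div_surjective (A := R) x
  have hb0 : b ≠ 0 := nonZeroDivisors.ne_zero hb
  clear hb
  have hinj : Function.Injective (algebraMap R K) := IsFractionRing.injective R K
  induction b using UniqueFactorizationMonoid.induction_on_prime generalizing a with
  | h₁ => exact absurd rfl hb0
  | h₂ u hu =>
    obtain ⟨u, rfl⟩ := hu
    refine ⟨a * ↑u⁻¹, ?_⟩
    rw [map_mul, eq_div_iff ((map_ne_zero_iff (algebraMap R K) hinj).2 hb0), mul_assoc,
      ← map_mul, Units.inv_mul, map_one, mul_one]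
  | h₃ c p hc hp ih =>
    obtain ⟨d, e, hpe, hde⟩ := hx p hp
    have hpc : algebraMap R K (p * c) ≠ 0 := (map_ne_zero_iff (algebraMap R K) hinj).2 hb0
    -- `a e = d p c` in `R`
    have h1 : a * e = d * (p * c) := by
      apply hinj
      rw [map_mul, map_mul, ← hde, div_mul_eq_mul_div, div_mul_cancel₀ _ hpc]
    have h2 : p ∣ a := by
      rcases hp.dvd_or_dvd (⟨d * c, by rw [h1]; ring⟩ : p ∣ a * e) with h | h
      · exact h
      · exact absurd h hpe
    obtain ⟨a', rfl⟩ := h2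
    have h3 : algebraMap R K (p * a') / algebraMap R K (p * c) =
        algebraMap R K a' / algebraMap R K c := by
      rw [map_mul, map_mul,
        mul_div_mul_left _ _ ((map_ne_zero_iff (algebraMap R K) hinj).2 hp.ne_zero)]
    rw [h3] at hx ⊢
    exact ih a' hx hc

/-! ### Principal radical ideals -/

/-- `(π) ∩ (m) = (π m)` for a prime element `π` not dividing `m`. [folklore] -/
theorem span_singleton_inf_span_singleton_of_not_dvd {π m : R} (hπ : Prime π) (h : ¬ π ∣ m) :
    span {π} ⊓ span {m} = span {π * m} := by
  apply le_antisymm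
  · rintro x ⟨hx₁, hx₂⟩
    obtain ⟨a, rfl⟩ := mem_span_singleton'.1 (show x ∈ span {π} from hx₁)
    obtain ⟨b, hb⟩ := mem_span_singleton'.1 (show a * π ∈ span {m} from hx₂)
    -- `b m = a π`, so `π ∣ b`
    have : π ∣ b * m := ⟨a, by rw [hb, mul_comm]⟩
    rcases hπ.dvd_or_dvd this with ⟨b', rfl⟩ | h'
    · refine mem_span_singleton'.2 ⟨b', ?_⟩
      have e : π * (b' * m) = π * a := by rw [← mul_assoc, hb, mul_comm]
      rw [← mul_left_cancel₀ hπ.ne_zero e]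
      ring
    · exact absurd h' h
  · rw [le_inf_iff]
    exact ⟨span_singleton_le_span_singleton.2 (dvd_mul_right π m),
      span_singleton_le_span_singleton.2 (dvd_mul_left m π)⟩

/-- `⋂ᵢ (πᵢ) = (∏ᵢ πᵢ)` for finitely many pairwise non-dividing prime elements (compare Mathlib
`Ideal.iInf_span_singleton`, which needs pairwise *coprime* generators). [folklore] -/
theorem iInf_span_singleton_eq_span_prod {ι : Type*} (s : Finset ι) (π : ι → R)
    (hπ : ∀ i ∈ s, Prime (π i)) (hne : ∀ i ∈ s, ∀ j ∈ s, i ≠ j → ¬ π i ∣ π j) :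
    ⨅ i ∈ s, span {π i} = span {∏ i ∈ s, π i} := by
  classical
  induction s using Finset.induction_on with
  | empty => simp
  | insert i s hi ih =>
    rw [Finset.iInf_insert, Finset.prod_insert hi,
      ih (fun j hj => hπ j (Finset.mem_insert_of_mem hj))
        (fun j hj k hk => hne j (Finset.mem_insert_of_mem hj) k (Finset.mem_insert_of_mem hk))]
    refine span_singleton_inf_span_singleton_of_not_dvd (hπ i (Finset.mem_insert_self i s)) ?_
    intro hdvd
    obtain ⟨j, hj, hij⟩ := (Prime.dvd_finsetProd_iff (hπ i (Finset.mem_insert_self i s)) _).1 hdvd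
    exact hne i (Finset.mem_insert_self i s) j (Finset.mem_insert_of_mem hj)
      (fun e => hi (e ▸ hj)) hij

/-- **A radical ideal of a noetherian factorial domain all of whose minimal primes have height one
is principal**: its minimal primes are `(π₁), …, (π_r)` with pairwise non-associated primes `πᵢ`
(Görtz–Wedhorn I, Prop. B.75 (2); Mathlib `UniqueFactorizationMonoid.isPrincipal_of_height_eq_one`),
and `I = √I = ⋂ (πᵢ) = (∏ πᵢ)`. (This is how "`D` is a Weil divisor ⇒ `D` is an effective
Cartier divisor since `X` is … locally factorial" is used in Görtz–Wedhorn II, Lemma 25.150.)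
[cite: GortzWedhorn2020, Prop. B.75 (2) (p. 571)] -/
theorem exists_eq_span_singleton_of_isRadical [IsNoetherianRing R] [UniqueFactorizationMonoid R]
    {I : Ideal R} (hI : I.IsRadical) (hmin : ∀ p ∈ I.minimalPrimes, p.height = 1) :
    ∃ j : R, I = span {j} := by
  classical
  have hfin := I.finite_minimalPrimes_of_isNoetherianRing
  -- prime generators of the minimal primes
  have hgen : ∀ p ∈ I.minimalPrimes, ∃ π : R, Prime π ∧ p = span {π} := fun p hp => by
    haveI := hp.1.1
    haveI := UniqueFactorizationMonoid.isPrincipal_of_height_eq_one (hmin p hp)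
    exact ⟨Submodule.IsPrincipal.generator p,
      Submodule.IsPrincipal.prime_generator_of_isPrime p (ne_bot_of_height_eq_one (hmin p hp)),
      (span_singleton_generator p).symm⟩
  choose! π hπ hπp using hgen
  refine ⟨∏ p ∈ hfin.toFinset, π p, ?_⟩
  have h1 : I = ⨅ p ∈ hfin.toFinset, span {π p} := by
    conv_lhs => rw [← hI.radical, ← Ideal.sInf_minimalPrimes, sInf_eq_iInf]
    apply le_antisymm
    · refine le_iInf₂ fun p hp => ?_
      rw [Set.Finite.mem_toFinset] at hp
      rw [← hπp p hp]
      exact iInf₂_le p hp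
    · refine le_iInf₂ fun p hp => ?_
      rw [hπp p hp]
      exact iInf₂_le p (hfin.mem_toFinset.2 hp)
  refine h1.trans (iInf_span_singleton_eq_span_prod _ _
    (fun p hp => hπ p (hfin.mem_toFinset.1 hp)) (fun p hp q hq hpq hdvd => hpq ?_))
  have hp' := hfin.mem_toFinset.1 hp
  have hq' := hfin.mem_toFinset.1 hq
  -- `π p ∣ π q` gives `q = (π q) ≤ (π p) = p`, so `p = q` by minimality of `p`
  have hle : q ≤ p := by
    rw [hπp p hp', hπp q hq']
    exact span_singleton_le_span_singleton.2 hdvd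
  exact le_antisymm (hp'.2 ⟨hq'.1.1, hq'.1.2⟩ hle) hle

end UFD

/-! ### Spreading out a local generator of a finitely generated ideal -/

section Spread

variable {S : Type*} [CommRing S] {J : Ideal S} {q : Ideal S} {j : S}

/-- If every element `x` of the finitely generated ideal `J` satisfies `t x ∈ j S` for some
`t ∉ 𝔮` (i.e. `J S_𝔮 ⊆ j S_𝔮`), then a single `g ∉ 𝔮` works for all `x ∈ J` (`𝔮` prime).
[folklore] -/
theorem exists_notMem_forall_mul_mem_of_fg [q.IsPrime] (hJ : J.FG)
    (H : ∀ x ∈ J, ∃ a t : S, t ∉ q ∧ t * x = j * a) :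
    ∃ g ∉ q, ∀ x ∈ J, ∃ a : S, g * x = j * a := by
  classical
  obtain ⟨s, rfl⟩ := hJ
  choose! a t ht hta using H
  refine ⟨∏ x ∈ s, t x, ?_, fun x hx => ?_⟩
  · exact fun h => by
      obtain ⟨x, hx, hx'⟩ := (‹q.IsPrime›.prod_mem_iff (s := s) (x := t)).1 h
      exact ht x (subset_span hx) hx'
  · refine Submodule.span_induction (p := fun x _ => ∃ a : S, (∏ x ∈ s, t x) * x = j * a)
      ?_ ⟨0, by simp⟩ ?_ ?_ hx
    · intro x hxs
      obtain ⟨c, hc⟩ : t x ∣ ∏ y ∈ s, t y := Finset.dvd_prod_of_mem t hxs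
      refine ⟨c * a x, ?_⟩
      rw [hc, mul_right_comm, hta x (subset_span hxs)]
      ring
    · rintro x y - - ⟨a₁, h₁⟩ ⟨a₂, h₂⟩
      exact ⟨a₁ + a₂, by rw [mul_add, h₁, h₂, mul_add]⟩
    · rintro c x - ⟨a₁, h₁⟩
      exact ⟨c * a₁, by rw [smul_eq_mul, mul_left_comm, h₁]; ring⟩

/-- From the localization at `𝔮`: if `J S_𝔮 ⊆ j S_𝔮` then every `x ∈ J` satisfies `t x ∈ j S`
for some `t ∉ 𝔮`. [folklore] -/
theorem exists_mul_eq_of_map_le_span [q.IsPrime] {A : Type*} [CommRing A] [Algebra S A]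
    [IsLocalization.AtPrime A q]
    (h : J.map (algebraMap S A) ≤ span {algebraMap S A j}) (x : S) (hx : x ∈ J) :
    ∃ a t : S, t ∉ q ∧ t * x = j * a := by
  obtain ⟨y, hy⟩ := mem_span_singleton'.1 (h (mem_map_of_mem _ hx))
  obtain ⟨⟨a, s⟩, hs⟩ := IsLocalization.surj q.primeCompl y
  -- `x s = j a` in `A`, hence `t (x s) = t (j a)` in `S` for some `t ∉ q`
  have e : algebraMap S A (x * s) = algebraMap S A (j * a) := by
    rw [map_mul, map_mul, ← hy, ← hs]; ring
  obtain ⟨t, ht⟩ := (IsLocalization.eq_iff_exists q.primeCompl A).1 e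
  refine ⟨t * a, t * s, fun hmem => ?_, ?_⟩
  · rcases ‹q.IsPrime›.mem_or_mem hmem with h' | h'
    · exact t.2 h'
    · exact s.2 h'
  · calc ↑t * ↑s * x = ↑t * (x * ↑s) := by ring
      _ = ↑t * (j * a) := ht
      _ = j * (↑t * a) := by ring

/-- To the localization at `𝔭 ∌ g`: if `g x ∈ j S` for all `x ∈ J` (and `j ∈ J`), then
`J S_𝔭 = j S_𝔭`. [folklore] -/
theorem map_eq_span_of_forall_mul_eq {p : Ideal S} [p.IsPrime] {g : S} (hg : g ∉ p) (hj : j ∈ J)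
    (H : ∀ x ∈ J, ∃ a : S, g * x = j * a) {B : Type*} [CommRing B] [Algebra S B]
    [IsLocalization.AtPrime B p] :
    J.map (algebraMap S B) = span {algebraMap S B j} := by
  apply le_antisymm
  · rw [map_le_iff_le_comap]
    intro x hx
    obtain ⟨a, ha⟩ := H x hx
    rw [mem_comap, mem_span_singleton']
    have hu : IsUnit (algebraMap S B g) :=
      IsLocalization.map_units B (⟨g, hg⟩ : p.primeCompl)
    refine ⟨algebraMap S B a * ↑hu.unit⁻¹, ?_⟩
    calc algebraMap S B a * ↑hu.unit⁻¹ * algebraMap S B j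
        = ↑hu.unit⁻¹ * algebraMap S B (j * a) := by rw [map_mul]; ring
      _ = ↑hu.unit⁻¹ * algebraMap S B (g * x) := by rw [ha]
      _ = ↑hu.unit⁻¹ * (↑hu.unit * algebraMap S B x) := by rw [map_mul, IsUnit.unit_spec]
      _ = algebraMap S B x := by rw [← mul_assoc, Units.inv_mul, one_mul]
  · rw [span_singleton_le_iff_mem]
    exact mem_map_of_mem _ hj

end Spread

end Literature.RingTheory.UniqueFactorizationDomain
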